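import Mathlib
import Summits.HodgeConjecture.HodgeConjecture.Theorems.R90S6ChartPushforwardAC

/-!
# R90 · S6 «Ch. 14.1–14.5 stable trace formula» — WAVE 2 helper W2-e: Lebesgue density on a real interval, read on the chart

The CONCRETE instance of ★ W2-b `R90.S6.chartPushforward_ac` (`Theorems/R90S6ChartPushforwardAC.lean`) that the
continuous-spectrum supplier of the (14.5.1) engine emits: Arthur's continuous `M`-terms ((2.3.4) p. 18) and the T1d
brackets are `dt`-integrals of intertwining traces against an `L¹` density over a compact real parameter interval `[a, b]`,
and the dichotomy text `HeckeContinuous` of `Cruxes/H413/Lines/R90_S6_StableTFSpectralB.lean` §E1 wants them as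
«atomless measure × `L¹` density» on the compact Satake chart `X ⊂ ℂ` (the `t = z + z⁻¹` coordinate, [Rogawski1990, §10.3
p. 159]).  If `[a, b] ⊂ X` (as a real segment of `ℂ`), then for every `d ∈ L¹([a, b])` there are an atomless measure `m` on `X`
and `d' ∈ L¹(m)` with `∫_{[a,b]} g(t) d(t) dt = ∫_X g · d' dm` for all `g ∈ C(X, ℂ)`.
PROOF: `Y := [a, b]` with `μ :=` Lebesgue measure pulled back to the subtype (finite; atomless by `Real.volume_singleton`),
density `d|_{[a,b]} ∈ L¹(μ)` (`integrableOn_iff_comap_subtypeVal`), chart map `s ↦ (s : ℂ) ∈ X` — a continuous injection from a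
compact space, hence a closed, hence measurable, embedding — and ★ `chartPushforward_ac` BY NAME.

Cell `hodgecm-mathlib`, crux H413 (`stmt-HodgeConjecture-24833`), route of record `HCCMUnconditional`; programme R90-TF
(brief `director/R90-BRIEF.v2.md`), section S6 (base `R90-C14`), seat R90-C14-p03 (g0); DEAL BY NAME 16:09:24Z (W2-e), sheet
`R90/R90-C14-plan/g0/S6_wave2e_target.v1.R90-C14-plan-g0.lean` c4f0ee2d42359a6a (signature verbatim, ns without `.Wave2`).
Lane `--supports stmt-HodgeConjecture-24833 --as helper`; ONE theorem, Mathlib + ★ `Theorems.R90S6ChartPushforwardAC` only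
(Theorems may import Theorems), no definition, no kit, no posited object, no `sorry`.
HONEST LABEL: this file proves no printed global statement; HC_CM is proved only modulo the 7 printed citations
(2 remaining named inputs: hLiu418 = stmt-HodgeConjecture-24832, h413 = stmt-HodgeConjecture-24833) until rung 0 closes.
-/

set_option autoImplicit false
-- the mandated namespace repeats the single-problem summit's segment (`HodgeConjecture.HodgeConjecture`)
set_option linter.dupNamespace false

open MeasureTheory

namespace Summit.HodgeConjecture.HodgeConjecture.R90.S6

/-- **(W2-e) Lebesgue density on a real interval inside the chart is «atomless measure × L¹ density» on the chart**
[Rogawski1990, §10.3 (10.3.2)–(10.3.3) p. 159 («extend to linear functionals on C … an absolutely continuous measure on X»);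
§2.3 (2.3.4) p. 18; §14.5 p. 240]: for a compact `X ⊂ ℂ` containing the real segment `[a, b]` and `d ∈ L¹([a, b])` there are a
measure `m` on `X` without atoms and `d' ∈ L¹(m)` such that `∫_{[a,b]} g((t : ℂ)) · d(t) dt = ∫_X g · d' dm` for every
`g ∈ C(X, ℂ)` — the expanded `HeckeContinuous` shape of FILE B for the functional `g ↦ ∫_{[a,b]} g · d`.  The concrete instance
(`Y := [a, b]`, Lebesgue, `t := s ↦ (s : ℂ)`) of ★ `R90.S6.chartPushforward_ac`.  (print: Rogawski1990, §10.3 p. 159; §2.3 p. 18) -/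
theorem intervalChart_ac (X : TopologicalSpace.Compacts ℂ) (a b : ℝ) (hX : ((↑) : ℝ → ℂ) '' Set.Icc a b ⊆ (X : Set ℂ))
    (d : ℝ → ℂ) (hd : IntegrableOn d (Set.Icc a b)) :
    ∃ (m : Measure X) (d' : X → ℂ), (∀ x : X, m {x} = 0) ∧ Integrable d' m ∧
      ∀ g : C(X, ℂ), ∫ t : Set.Icc a b, g ⟨((t : ℝ) : ℂ), hX ⟨t, t.2, rfl⟩⟩ * d t ∂(Measure.comap Subtype.val volume) =
        ∫ x, g x * d' x ∂m := by
  -- the source `Y := [a, b]` with Lebesgue measure pulled back to the subtype: finite and atomless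
  have hemb : MeasurableEmbedding (Subtype.val : Set.Icc a b → ℝ) := MeasurableEmbedding.subtype_coe measurableSet_Icc
  have happ : ∀ s : Set (Set.Icc a b), (Measure.comap Subtype.val volume : Measure (Set.Icc a b)) s = volume (Subtype.val '' s) :=
    fun s => hemb.comap_apply volume s
  haveI : IsFiniteMeasure (Measure.comap Subtype.val volume : Measure (Set.Icc a b)) := ⟨by
    rw [happ, Set.image_univ, Subtype.range_coe]
    exact measure_Icc_lt_top⟩
  have hμ0 : ∀ y : Set.Icc a b, (Measure.comap Subtype.val volume : Measure (Set.Icc a b)) {y} = 0 := fun y => by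
    rw [happ, Set.image_singleton, Real.volume_singleton]
  -- the density restricted to the subtype is `L¹`
  have hd0 : Integrable (fun y : Set.Icc a b => d y) (Measure.comap Subtype.val volume) :=
    (integrableOn_iff_comap_subtypeVal measurableSet_Icc).mp hd
  -- the chart map `s ↦ (s : ℂ)`: a continuous injection from a compact space, hence a measurable embedding
  have htc : Continuous fun s : Set.Icc a b => (⟨((s : ℝ) : ℂ), hX ⟨s, s.2, rfl⟩⟩ : X) :=
    (Complex.continuous_ofReal.comp continuous_subtype_val).subtype_mk _
  have hti : Function.Injective fun s : Set.Icc a b => (⟨((s : ℝ) : ℂ), hX ⟨s, s.2, rfl⟩⟩ : X) :=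
    fun s₁ s₂ h => Subtype.ext (Complex.ofReal_injective (congrArg Subtype.val h))
  have ht : MeasurableEmbedding fun s : Set.Icc a b => (⟨((s : ℝ) : ℂ), hX ⟨s, s.2, rfl⟩⟩ : X) :=
    (htc.isClosedEmbedding hti).measurableEmbedding
  -- ★ W2-b by name
  obtain ⟨m, d', hm, hd', hint⟩ :=
    chartPushforward_ac X (Measure.comap Subtype.val volume) hμ0 (fun y : Set.Icc a b => d y) hd0 _ ht
  exact ⟨m, d', hm, hd', fun g => hint g⟩

end Summit.HodgeConjecture.HodgeConjecture.R90.S6
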